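import Summits.KontsevichZagierPeriods.KontsevichZagierPeriods.Theorems.RootDecompZetaThreeFrontierWordRungTwoP5

/-! # `RootDecompZetaThreeFrontierWordRungTwoP6` — part 6/12 of the mechanical ≤270-line split of `RungTwo.stripped.lean`
(split by the decomp-kz census seat for landing; mathematics unchanged; part 6 continues part 5). -/

noncomputable section

namespace Summit.KontsevichZagierPeriods.RootDecompZetaThreeFrontier.WordLayer
open Set MeasureTheory MvPolynomial
open Literature.NumberTheory.Transcendental
open Summit.KontsevichZagierPeriods.KontsevichZagierPeriods.Theses.RootDecompZetaThreeFrontier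
  (HigherWeightDescent)
open Summit.KontsevichZagierPeriods.KontsevichZagierPeriods.Theses.LinRedNormalForm
  (DihedralNormalForm MzvKernelInKZ HoffmanSpanInKZ HoffmanIndependence)

section CornerClasses
open Literature.ModelTheory.ExponentialFields (IsSemialgebraic)













/-! (private copy of `snoc_one_zero` — its public twin in this chain was privatised under the dedup.landed policy) -/
/-- Auxiliary step `snoc_one_zero`. [bookkeeping] -/
private theorem snoc_one_zero (x : Fin 1 → ℝ) (t : ℝ) : (Fin.snoc x t : Fin 2 → ℝ) 0 = x 0 := rfl

/-! (private copy of `snoc_one_one` — its public twin in this chain was privatised under the dedup.landed policy) -/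
/-- Auxiliary step `snoc_one_one`. [bookkeeping] -/
private theorem snoc_one_one (x : Fin 1 → ℝ) (t : ℝ) : (Fin.snoc x t : Fin 2 → ℝ) 1 = t := rfl

/-! (private copy of `of_mem_relations_of_integrand_zero` — dedup.landed / split policy; origin part RootDecompZetaThreeFrontierWordRungTwoP1) -/
/-- A representation whose integrand vanishes on its domain is a relation (rule 1b: `f = f + f`). -/
private theorem of_mem_relations_of_integrand_zero {n : ℕ} (z : KZ.IntegralRep n)
    (hz : ∀ x ∈ z.domain, z.integrand x = 0) : KZ.of z ∈ KZ.relations := by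
  have h3 : KZ.of z - KZ.of z - KZ.of z ∈ KZ.relations :=
    KZ.integrandAddRel_subset_relations ⟨n, z, z, z, rfl, rfl, fun x hx => by simp [hz x hx], rfl⟩
  rw [show KZ.of z - KZ.of z - KZ.of z = -KZ.of z by abel] at h3
  exact neg_mem_iff.mp h3

/-! (private copy of `adm_two` — dedup.landed / split policy; origin part RootDecompZetaThreeFrontierWordRungTwoP1) -/
/-- Auxiliary step `adm_two`. [bookkeeping] -/
private theorem adm_two : MZV.IsAdmissible [2] := by decide

/-! (private copy of `mem_simplex_two_iff` — dedup.landed / split policy; origin part RootDecompZetaThreeFrontierWordRungTwoP1) -/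
/-- Membership in `simplex_two_iff`, unfolded. [bookkeeping] -/
private theorem mem_simplex_two_iff (z : Fin 2 → ℝ) :
    z ∈ KZ.openOrderedSimplex 2 ↔ 0 < z 1 ∧ z 1 < z 0 ∧ z 0 < 1 := by
  constructor
  · rintro ⟨h0, h1, ha⟩
    exact ⟨h0 1, ha (show (0 : Fin 2) < 1 by decide), h1 0⟩
  · rintro ⟨h1, h10, h0⟩
    refine ⟨Fin.forall_fin_two.mpr ⟨h1.trans h10, h1⟩, Fin.forall_fin_two.mpr ⟨h0, h10.trans h0⟩,
      Fin.strictAnti_iff_succ_lt.mpr (Fin.forall_fin_one.mpr ?_)⟩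
    simpa using h10

/-- one rule-1b split (difference form): if `r₁.integrand = r.integrand + r₂.integrand` on the common domain `Δ₂` and `[r₁]`, `[r₂]` lie
in the weight-`≤ 2` word span modulo relations, then so does `[r]` -/
theorem of_sub_split (r r₁ r₂ : KZ.IntegralRep 2) (hd : r.domain = KZ.openOrderedSimplex 2)
    (hd₁ : r₁.domain = KZ.openOrderedSimplex 2) (hd₂ : r₂.domain = KZ.openOrderedSimplex 2)
    (hsplit : ∀ z ∈ KZ.openOrderedSimplex 2, r₁.integrand z = r.integrand z + r₂.integrand z)
    (h₁ : ∃ m ∈ AddSubgroup.closure (wordGensLE 2), KZ.of r₁ - m ∈ KZ.relations)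
    (h₂ : ∃ m ∈ AddSubgroup.closure (wordGensLE 2), KZ.of r₂ - m ∈ KZ.relations) :
    ∃ m ∈ AddSubgroup.closure (wordGensLE 2), KZ.of r - m ∈ KZ.relations := by
  obtain ⟨m₁, hm₁, h₁⟩ := h₁
  obtain ⟨m₂, hm₂, h₂⟩ := h₂
  have h : KZ.of r₁ - KZ.of r - KZ.of r₂ ∈ KZ.relations :=
    KZ.integrandAddRel_subset_relations ⟨2, r₁, r, r₂, by rw [hd, hd₁], by rw [hd₂, hd₁], fun z hz => by
      rw [Pi.add_apply]; rw [hd₁] at hz; exact hsplit z hz, rfl⟩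
  refine ⟨m₁ - m₂, sub_mem hm₁ hm₂, ?_⟩
  have e : KZ.of r - (m₁ - m₂) = (KZ.of r₁ - m₁) - (KZ.of r₂ - m₂) - (KZ.of r₁ - KZ.of r - KZ.of r₂) := by abel
  rw [e]
  exact sub_mem (sub_mem h₁ h₂) h

/-- one rule-1b split (sum form): `r.integrand = r₁.integrand + r₂.integrand` -/
theorem of_add_split (r r₁ r₂ : KZ.IntegralRep 2) (hd : r.domain = KZ.openOrderedSimplex 2)
    (hd₁ : r₁.domain = KZ.openOrderedSimplex 2) (hd₂ : r₂.domain = KZ.openOrderedSimplex 2)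
    (hsplit : ∀ z ∈ KZ.openOrderedSimplex 2, r.integrand z = r₁.integrand z + r₂.integrand z)
    (h₁ : ∃ m ∈ AddSubgroup.closure (wordGensLE 2), KZ.of r₁ - m ∈ KZ.relations)
    (h₂ : ∃ m ∈ AddSubgroup.closure (wordGensLE 2), KZ.of r₂ - m ∈ KZ.relations) :
    ∃ m ∈ AddSubgroup.closure (wordGensLE 2), KZ.of r - m ∈ KZ.relations := by
  obtain ⟨m₁, hm₁, h₁⟩ := h₁
  obtain ⟨m₂, hm₂, h₂⟩ := h₂
  have h : KZ.of r - KZ.of r₁ - KZ.of r₂ ∈ KZ.relations :=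
    KZ.integrandAddRel_subset_relations ⟨2, r, r₁, r₂, by rw [hd, hd₁], by rw [hd₂, hd], fun z hz => by
      rw [Pi.add_apply]; rw [hd] at hz; exact hsplit z hz, rfl⟩
  refine ⟨m₁ + m₂, add_mem hm₁ hm₂, ?_⟩
  have e : KZ.of r - (m₁ + m₂) = (KZ.of r - KZ.of r₁ - KZ.of r₂) + (KZ.of r₁ - m₁) + (KZ.of r₂ - m₂) := by abel
  rw [e]
  exact add_mem (add_mem h h₁) h₂

/-- base: `q·C(0,0;1,1) = q·ω₀ω₁` is the word generator `[Δ₂, q·ω₀ω₁]` of weight `2` -/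
theorem cc_zero_zero_one_one (q : ℚ) (r : KZ.IntegralRep 2) (hd : r.domain = KZ.openOrderedSimplex 2)
    (hi : EqOn r.integrand (fun z => (q : ℝ) * cc 0 0 1 1 z) r.domain) :
    ∃ m ∈ AddSubgroup.closure (wordGensLE 2), KZ.of r - m ∈ KZ.relations := by
  refine ⟨KZ.of (k2 q), AddSubgroup.subset_closure (of_canonA_mem_wordGensLE [2] adm_two q (by decide)), ?_⟩
  set z₀ : KZ.IntegralRep 2 := repTwo (fun _ => 0)
    ((isSemialgebraicFunOn_aeval (KZ.isSemialgebraic_openOrderedSimplex 2) (0 : MvPolynomial (Fin 2) ℚ)).congr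
      fun y _ => by simp) integrableOn_zero with hz₀
  have h1 : KZ.of r - KZ.of (k2 q) - KZ.of z₀ ∈ KZ.relations :=
    KZ.integrandAddRel_subset_relations ⟨2, r, k2 q, z₀, by rw [hd, k2_domain]; rfl, by rw [hd]; rfl, fun z hz => by
      rw [Pi.add_apply, hi hz, k2_integrand]
      show (q : ℝ) * cc 0 0 1 1 z = (q : ℝ) / (z 0 * (1 - z 1)) + 0
      simp only [cc, pow_zero, pow_one, one_mul, add_zero, mul_one_div], rfl⟩
  have h2 : KZ.of z₀ ∈ KZ.relations := of_mem_relations_of_integrand_zero z₀ fun _ _ => rfl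
  have e : KZ.of r - KZ.of (k2 q) = (KZ.of r - KZ.of (k2 q) - KZ.of z₀) + KZ.of z₀ := by abel
  rw [e]
  exact add_mem h1 h2

/-- `j`-induction at `k = 0`: `C(j+1,0;1,1) = C(j,0;1,1) - C(j,0;1,0)` (`t₁^{j+1} = t₁^j - t₁^j(1-t₁)`) -/
theorem cc_j_zero_one_one (q : ℚ) (j : ℕ) : ∀ (r : KZ.IntegralRep 2), r.domain = KZ.openOrderedSimplex 2 →
    EqOn r.integrand (fun z => (q : ℝ) * cc j 0 1 1 z) r.domain →
    ∃ m ∈ AddSubgroup.closure (wordGensLE 2), KZ.of r - m ∈ KZ.relations := by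
  induction j with
  | zero => exact cc_zero_zero_one_one q
  | succ j ih =>
    intro r hd hi
    refine of_sub_split r (ccRep q j 0 1 1 (by omega) (by omega)) (ccRep q j 0 1 0 (by omega) (by omega)) hd rfl rfl
      (fun z hz => ?_) (ih _ rfl fun _ _ => rfl) ?_
    · rw [hi (by rw [hd]; exact hz)]
      obtain ⟨h1, h10, h0⟩ := (mem_simplex_two_iff z).1 hz
      have h1' : (1 : ℝ) - z 1 ≠ 0 := by linarith
      have hz0 : z 0 ≠ 0 := (h1.trans h10).ne'
      show (q : ℝ) * cc j 0 1 1 z = (q : ℝ) * cc (j + 1) 0 1 1 z + (q : ℝ) * cc j 0 1 0 z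
      simp only [cc, pow_zero, mul_one, pow_succ]
      field_simp
      ring
    · obtain ⟨m, hm, h⟩ := cc_gamma_zero q j 0 1 (by omega) (ccRep q j 0 1 0 (by omega) (by omega)) rfl fun _ _ => rfl
      exact ⟨m, closure_zero_le_two hm, h⟩

/-- **the simple-pole classes `q·C(j,k;1,1)` lie in `ℚ·[Δ₂, ω₀ω₁] + ℚ·[pt]` modulo relations**, for ALL `q, j, k`:
`k`-induction `C(j,k+1;1,1) = C(j,k;1,1) - C(j,k;0,1)` (`(1-t₀)^{k+1} = (1-t₀)^k - t₀(1-t₀)^k`) down to `k = 0`, then the `j`-induction. -/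
theorem cc_one_one (q : ℚ) (j k : ℕ) : ∀ (r : KZ.IntegralRep 2), r.domain = KZ.openOrderedSimplex 2 →
    EqOn r.integrand (fun z => (q : ℝ) * cc j k 1 1 z) r.domain →
    ∃ m ∈ AddSubgroup.closure (wordGensLE 2), KZ.of r - m ∈ KZ.relations := by
  induction k with
  | zero => exact cc_j_zero_one_one q j
  | succ k ih =>
    intro r hd hi
    refine of_sub_split r (ccRep q j k 1 1 (by omega) (by omega)) (ccRep q j k 0 1 (by omega) (by omega)) hd rfl rfl
      (fun z hz => ?_) (ih _ rfl fun _ _ => rfl) ?_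
    · rw [hi (by rw [hd]; exact hz)]
      obtain ⟨h1, h10, h0⟩ := (mem_simplex_two_iff z).1 hz
      have h1' : (1 : ℝ) - z 1 ≠ 0 := by linarith
      have hz0 : z 0 ≠ 0 := (h1.trans h10).ne'
      show (q : ℝ) * cc j k 1 1 z = (q : ℝ) * cc j (k + 1) 1 1 z + (q : ℝ) * cc j k 0 1 z
      simp only [cc, pow_zero, one_mul, pow_succ]
      field_simp
      ring
    · obtain ⟨m, hm, h⟩ := cc_beta_zero q j k 1 (by omega) (ccRep q j k 0 1 (by omega) (by omega)) rfl fun _ _ => rfl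
      exact ⟨m, closure_zero_le_two hm, h⟩

/-! ### 16c  THE LOW-POLE LAYER OF RUNG 2: `[Δ₂, P(t₀,t₁)/(t₀^β(1-t₁)^γ)]`, `β, γ ≤ 1`, for EVERY polynomial `P ∈ ℚ[t₀,t₁]` -/

/-- every class `q·C(j,k;β,γ)` with `β, γ ≤ 1` lies in the weight-`≤ 2` word span modulo relations (the four cases above) -/
theorem cc_le_one (q : ℚ) (j k β γ : ℕ) (hβ : β ≤ 1) (hγ : γ ≤ 1) (r : KZ.IntegralRep 2)
    (hd : r.domain = KZ.openOrderedSimplex 2) (hi : EqOn r.integrand (fun z => (q : ℝ) * cc j k β γ z) r.domain) :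
    ∃ m ∈ AddSubgroup.closure (wordGensLE 2), KZ.of r - m ∈ KZ.relations := by
  interval_cases β <;> interval_cases γ
  · obtain ⟨m, hm, h⟩ := cc_gamma_zero q j k 0 (Nat.zero_le _) r hd hi
    exact ⟨m, closure_zero_le_two hm, h⟩
  · obtain ⟨m, hm, h⟩ := cc_beta_zero q j k 1 (by omega) r hd hi
    exact ⟨m, closure_zero_le_two hm, h⟩
  · obtain ⟨m, hm, h⟩ := cc_gamma_zero q j k 1 (by omega) r hd hi
    exact ⟨m, closure_zero_le_two hm, h⟩
  · exact cc_one_one q j k r hd hi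

end CornerClasses
/-! ## §17  BY-NAME CLOSURE (gen 9 addendum 3, after the writer's g4 edit of 11:17Z and the census landing of the move facts):
the BORN support item `Theses.RootDecompZetaThreeFrontier.GZNormalFormWThree` (rank 9, filed by decomp-kz-writer-1 g4 from
`g9/bc/RouteVocab.lean`) is this file's `GZNormalFormWThree'` VERBATIM (`Iff.rfl`), hence **item 28709's decl follows from the born
support decl — both ends BY NAME, std axioms**; and the two LANDED tree theorems
`Theorems.RootDecompZetaThreeFrontierWordMoves.{divergenceLEThree, dualityThree}` (census-1 landing of `g9/landing/`, p-ids on the bus)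
have exactly the types `DivergenceLEThree`, `DualityThree'` of §10/§13 (term-level `example`s). -/

section ByName
end ByName
/-! ## §18  THE NEW MOVE OF DIMENSION 3, CERTIFIED (gen 9 addendum 4, `RUNG3.md` §3 B3): the DIAGONAL-STRAIGHTENING
chart `Σ : (t₀,t₁,t₂) ↦ ((t₀-t₂)/(1-t₂), (t₁-t₂)/(1-t₂), t₂)` as ONE rule-(2) relation of `KZCalculus`.
We apply `changeOfVariablesRel` with the POLYNOMIAL inverse `Σ⁻¹ = stΨ : (u,v,s) ↦ (s + u(1-s), s + v(1-s), s)` from the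
straightened cell `stDom = Δ₂(u,v) × (0,1)` onto `Δ₃`; `|det D stΨ| = (1-s)²`.  The diagonal factor `t₀ - t₂` becomes the
coordinate factor `u (1-s)`: this is the move that unblocks the Newton–Leibniz-stuck family `t₀^m/(t₁(t₀-t₂))` (RUNG3.md §3). -/

section Straighten
open Literature.ModelTheory.ExponentialFields
/-! ### 18b  The affine un-bending chart `τ_v : (u,v,s) ↦ (u, v, v + s(1-v))` (rule (2), polynomial, `|det| = 1-v`)
from `stDom` onto the cell `stCell = {1 > u > v > 0, v < w < 1}`; after it EVERY factor of a straightened reduced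
genus-zero datum is a coordinate or `1 -` a coordinate, and rule (1a) along `u = w` lands in two simplices. -/

/-! ### 18c  CONSTRUCTORS: the straightened / un-bent representations as `IntegralRep`s (integrability transported by
the Jacobian formula, semialgebraicity by Tarski–Seidenberg), so that a prover chains the two charts with NO measure
theory: `straighten_rel'`, `bend_rel'`, `straighten_bend_rel'`. -/

/-! ### 18d  The rule-(1a) split of the un-bent cell along `u = w` and the coordinate swap onto `Δ₃`:
`stCell = cellA ⊔ cellB`, `cellA = {1 > u > w > v > 0}` (the swap `(u,v,w) ↦ (u,w,v)` of `Δ₃`),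
`cellB = {1 > w ≥ u > v > 0}` (`Δ₃` in the order `(w,u,v)` up to the null plane `u = w`).  With 18c this completes
B3 of `RUNG3.md` §3 as kernel theorems: every class on `Δ₃` is congruent to a sum of two classes whose every factor,
for a straightened reduced genus-zero datum, is a coordinate or `1 -` a coordinate. -/

/-! ### 18e  THE NEW MOVE IN ACTION (kernel): the DIAGONAL-POLE class `H_q = [Δ₃, q/((t₀-t₂) t₁ (1-t₂))]`
(Newton–Leibniz-stuck in every variable; `RUNG3.md` §3 B3, second bullet) is congruent to `[k3 q] + [k3 q]`
(value `2q·ζ(3)`) by the moves Σ, τ_v, the `u = w` split, one swap and one rotation — and therefore lies in the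
`GZNormalFormW 3` closure.  Six moves, every one absolutely convergent and `ℚ`-semialgebraic. -/

/-! ### 18f  `G₀` IN THE KERNEL: the NL-STUCK class `[Δ₃, q/(t₁(t₀-t₂))]` lies in the `GZNormalFormW 3` closure (value `q ζ(2)`;
`RUNG3.md` §3 B3 first bullet, re-routed through §16): Σ, τ_v, the `u = w` split, swap / rotation onto `Δ₃`, then ONE
Newton–Leibniz move per piece (`nl_three`) down to a rung-2 LOW-POLE class, closed by `lowPoleLayer_two`. -/

/-! #### the two pieces after straightening, as Newton–Leibniz data on the closed band -/

end Straighten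
/-! ## §19  ALL CORNER CLASSES OF RUNG 2 (gen 10): the TWO-TERM `γ`-STEP.
For `γ = g+2 ≤ k+1`, `β ≤ j+1` the primitive `F = (q/(g+1))·C(j+1,k;β,g+1)` — a polynomial times `(1-t₁)^{-(g+1)} t₀^{-β}`,
continuous on the CLOSED fibre `[0,t₀]`, with `F(t₀,0) = 0` and `F(t₀,t₀) = (q/(g+1))·t₀^{j+1-β}(1-t₀)^{k-g-1}` a POLYNOMIAL — has
`∂₁F = q·C(j,k;β,g+2) + c·C(j,k;β,g+1)`, `c = q(j-g)/(g+1)` (from `t₁^{j+1}/(1-t₁)^{g+2} = t₁^j/(1-t₁)^{g+2} - t₁^j/(1-t₁)^{g+1}`).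
So ONE (E1) move + ONE rule-1b split + rung 1 lower `γ` by one, every intermediate representation absolutely convergent (all three
classes have `β ≤ j+1`, `γ ≤ k+1`); (E2) does the same for `β`.  Consequently EVERY class `q·C(j,k;β,γ)` with `β ≤ j+1`, `γ ≤ k+1`
— i.e. every absolutely convergent corner class — lies in the weight-`≤ 2` word span modulo `KZ.relations`: the Taylor /
regularisation step (S3/S4 of NODE §(E)) of the rung-2 algorithm needs NO logarithmic primitives and NO partial fractions. -/

section CornerClassesAll
open Literature.ModelTheory.ExponentialFields (IsSemialgebraic)
/-- Auxiliary step `cc_snoc`. [bookkeeping] -/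
theorem cc_snoc (j k β γ : ℕ) (y : Fin 1 → ℝ) (t : ℝ) :
    cc j k β γ (Fin.snoc y t) = t ^ j * (1 - y 0) ^ k / (y 0 ^ β * (1 - t) ^ γ) := by
  simp only [cc, snoc_one_zero, snoc_one_one]

end CornerClassesAll
end Summit.KontsevichZagierPeriods.RootDecompZetaThreeFrontier.WordLayer
end
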